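import Summits.AtomisticToContinuum.Crystallization.Theorems.HullExactificationCascadeZeroDefectDensityReduction
import Summits.AtomisticToContinuum.Crystallization.Theorems.HullExactificationCascadeZeroDefectDensityPins
import Summits.AtomisticToContinuum.Crystallization.Theorems.HullExactificationCascadeZeroDefectDensityCoordsFcc
import Summits.AtomisticToContinuum.Crystallization.Theorems.HullExactificationCascadeZeroDefectDensityCoordsHcp
import HarnessLib

/-!
# REDUCTION of the crux `ZeroDefectDensity` (stmt-AtomisticToContinuum-12086) to its two open inputs
# — line `birth`, lead c4, final form

`zeroDefectDensity_reduction_of_softKissingOrder_of_localHalesKernel`: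

  soft kissing order a.e. in LJ ground states (`stub_softKissingOrder`, ENERGETIC, open)
  ∧ effective local Hales at tolerance `1/400` (= `BrittleRungDescent.LocalHalesKernel`, stmt-9208, open)
  ⟹ `HullExactificationCascade.ZeroDefectDensity`.

Obtained from the landed five-hypothesis reduction `zeroDefectDensity_reduction` (p155168) by discharging the three
provable stubs of the line with their landed proofs: `stub_pins` (p155647), `stub_coordsFcc`, `stub_coordsHcp`.
Every other step of the line — scaling, link lemma, octahedron, cap atoms, quantitative link lemma, pins, fcc/hcp
coordinates, the frame toolkit and the shell bookkeeping — is a theorem of the tree; the two displayed hypotheses are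
exactly the registered open stubs of `Cruxes/ZeroDefectDensity/Lines/birth.lean`. [folklore]
-/

noncomputable section

namespace Summit.AtomisticToContinuum.Crystallization.Theorems.ZeroDefectDensityBirth

/-- **THE REDUCTION (final form; registered sub-goal).**  Soft kissing order a.e. (tolerance `1/4000`, two shells
deep, gap `1.31`) and effective local Hales at tolerance `1/400` (stmt-9208) imply the crux
`HullExactificationCascade.ZeroDefectDensity`. [folklore] -/
theorem zeroDefectDensity_reduction_of_softKissingOrder_of_localHalesKernel : (∀ (x : (N : ℕ) → (Fin N → EuclideanSpace ℝ (Fin 3))), (∀ N, Literature.MathematicalPhysics.StatisticalMechanics.IsGroundState Literature.MathematicalPhysics.StatisticalMechanics.lennardJones (x N)) → Filter.Tendsto (fun N : ℕ => (Nat.card {i : Fin N // ¬ (∃ a : ℝ, 0 < a ∧ ∀ v ∈ Set.range (x N), dist (x N i) v ≤ 13 / 5 * a → ((∀ w ∈ Set.range (x N), w ≠ v → (1 - 1 / 4000) * a ≤ dist v w ∧ (dist v w ≤ (1 + 1 / 4000) * a ∨ 131 / 100 * a ≤ dist v w)) ∧ {w ∈ Set.range (x N) | w ≠ v ∧ dist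 v w ≤ (1 + 1 / 4000) * a}.ncard = 12))} : ℝ) / (N : ℝ)) Filter.atTop (nhds (0 : ℝ))) → (∀ (S : Set (EuclideanSpace ℝ (Fin 3))) (u : EuclideanSpace ℝ (Fin 3)), u ∈ S → (∀ v ∈ S, dist u v ≤ 1 + 1 / 400 → ((∀ w ∈ S, w ≠ v → 1 - 1 / 400 ≤ dist v w ∧ (dist v w ≤ 1 + 1 / 400 ∨ 63 / 50 ≤ dist v w)) ∧ {w ∈ S | w ≠ v ∧ dist v w ≤ 1 + 1 / 400}.ncard = 12)) → ((∃ e : {w : EuclideanSpace ℝ (Fin 3) // w ∈ S ∧ w ≠ u ∧ dist u w ≤ 1 + 1 / 400} ≃ {q : EuclideanSpace ℝ (Fin 3) // q ∈ Literature.Geometry.DiscreteGeometry.fccKissingPattern}, ∀ w w' : {w : EuclideanSpace ℝ (Fin 3) // w ∈ S ∧ w ≠ u ∧ dist u w ≤ 1 + 1 / 400}, w ≠ w' → (dist w.1 w'.1 ≤ 1 + 1 / 400 ↔ dist (e w).1 (e w').1 = 1)) ∨ (∃ e : {w : EuclideanSpace ℝ (Fin 3) // w ∈ S ∧ w ≠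 u ∧ dist u w ≤ 1 + 1 / 400} ≃ {q : EuclideanSpace ℝ (Fin 3) // q ∈ Literature.Geometry.DiscreteGeometry.hcpKissingPattern}, ∀ w w' : {w : EuclideanSpace ℝ (Fin 3) // w ∈ S ∧ w ≠ u ∧ dist u w ≤ 1 + 1 / 400}, w ≠ w' → (dist w.1 w'.1 ≤ 1 + 1 / 400 ↔ dist (e w).1 (e w').1 = 1)))) → Summit.AtomisticToContinuum.Crystallization.Theses.HullExactificationCascade.ZeroDefectDensity :=
  fun hSKO hLHK => zeroDefectDensity_reduction hSKO hLHK stub_pins stub_coordsFcc stub_coordsHcp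

end Summit.AtomisticToContinuum.Crystallization.Theorems.ZeroDefectDensityBirth

end
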